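import Literature.Computability.AlgebraicComplexity.DeterminantalIdeal
import Literature.Computability.AlgebraicComplexity.SecondFundamentalTheoremGLProofs
import HarnessLib

/-!
# Determinantal ideals as vanishing ideals (Second Fundamental Theorem for `GL_t`), proved forms

Let `X` be the generic `m × n` matrix and `t : ℕ`. Over `ℂ`, the ideal of polynomials vanishing
on the determinantal variety `DV_{m,n,t}` = {matrices of rank `≤ t`} = `{x y : x ∈ M_{m,t},
y ∈ M_{t,n}}` is the determinantal ideal `I_{t+1}(X) = determinantalIdeal m n ℂ (t + 1)`
(**Second Fundamental Theorem of invariant theory for `GL_t`**: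
Arbarello–Cornalba–Griffiths–Harris 1985, Ch. II §3; Goodman–Wallach 2009,
Thm. 12.2.12 (1); Weyl 1939; De Concini–Eisenbud–Procesi 1980; Bruns–Vetter 1988). The tree
already holds this theorem, PROVED, in the `Fin`-indexed rank form
`Literature.Computability.AlgebraicComplexity.ArbarelloEtAl1985_secondFundamentalTheorem`
(`SecondFundamentalTheoremGL.lean`, discharged by `…_holds` in
`SecondFundamentalTheoremGLProofs.lean`) for the older `Fin`-indexed ideal
`detIdeal ℂ m n (t + 1)` (`BideterminantReduction.lean`). This file transports it to
`determinantalIdeal` (arbitrary finite index types; `Iff.rfl`-compatible with route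
HartogsRankTwo) and adds the comorphism / kernel / primality forms. EVERYTHING HERE IS PROVED;
no named facts.

## Contents

* `determinantalIdeal_eq_detIdeal`: `determinantalIdeal (Fin m) (Fin n) F r = detIdeal F m n r`.
* `rename_genericMinor`, `determinantalIdeal_le_comap_rename`, `rename_mem_determinantalIdeal_iff`:
  functoriality of `I_r(X)` under re-indexing rows and columns.
* `genericProductHom m n R t` — the comorphism `μ^* : R[X] → R[Y, Z]`, `X ↦ Y Z` of matrix
  multiplication `M_{m,t} × M_{t,n} → M_{m,n}` (Goodman–Wallach §5.2.1/§12.2.4), with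
  `eval_genericProductHom` and the easy inclusion `I_{t+1}(X) ≤ ker μ^*` over any commutative
  ring (`determinantalIdeal_le_ker_genericProductHom`).
* `forall_rank_le_eval_eq_zero_iff` (rank form, all `t`, any finite `m n`):
  `(∀ A, rank A ≤ t → P(A) = 0) ↔ P ∈ I_{t+1}(X)`; the degenerate range
  `t ≥ min (#m, #n)` (Goodman–Wallach Cor. 5.2.5 (1)) is
  `forall_rank_le_eval_eq_zero_iff_of_card_le`.
* `eval_mul_eq_zero_iff_mem_determinantalIdeal` (product form `P (x * y) = 0 ∀ x y`),
  `forall_eval_sum_mul_eq_zero_iff` (`U Vᵀ` form, entries `∑ k, U i k * V j k` as in route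
  HartogsRankTwo), `ker_genericProductHom_eq_determinantalIdeal` (`ker μ^* = I_{t+1}(X)`),
  `determinantalIdeal_isPrime`, `determinantalIdeal_isRadical` — all over `ℂ`, unconditional.

The literal statement of route item `KernelIsMinors` is already the tree theorem
`ArbarelloEtAl1985_secondFundamentalTheorem.kernelIsMinors` (with `…_holds`); it is not restated.

## Design notes

* Over a finite field the pointwise statements are false (`x^q - x` vanishes everywhere); the
  ring-theoretic content valid over every commutative ring is the inclusion
  `determinantalIdeal_le_ker_genericProductHom`. TODO(general form): equality `ker μ^* = I_{t+1}`
  and primality over an arbitrary domain (De Concini–Eisenbud–Procesi 1980; Bruns–Vetter 1988;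
  Hochster–Eagon 1971) are not in the tree.
-/

noncomputable section

open MvPolynomial Matrix

namespace Literature.Computability.AlgebraicComplexity

universe u v w

variable {m : Type u} {n : Type v} (R : Type w) [CommRing R]

section Bridge

/-- The general determinantal ideal specialises to the tree's `Fin`-indexed `detIdeal`
(`BideterminantReduction.lean`): `determinantalIdeal (Fin m) (Fin n) F r = detIdeal F m n r`.
[folklore] -/
theorem determinantalIdeal_eq_detIdeal (F : Type*) [Field F] (m n r : ℕ) :
    determinantalIdeal (Fin m) (Fin n) F r = detIdeal F m n r :=
  (detIdeal_eq_span_range F m n r).symm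

/-- Re-indexing rows by `f` and columns by `g` sends the generic minor `[ρ | γ]` to the generic
minor `[f ∘ ρ | g ∘ γ]`. [folklore] -/
theorem rename_genericMinor {m' : Type*} {n' : Type*} (f : m → m') (g : n → n') {r : ℕ}
    (ρ : Fin r → m) (γ : Fin r → n) :
    MvPolynomial.rename (Prod.map f g) (genericMinor R ρ γ) =
      genericMinor R (f ∘ ρ) (g ∘ γ) := by
  rw [genericMinor, genericMinor, AlgHom.map_det]
  congr 1
  ext i j
  simp

/-- Functoriality: re-indexing maps `I_r(X)` into `I_r(X')`. [folklore] -/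
theorem determinantalIdeal_le_comap_rename {m' : Type*} {n' : Type*} (f : m → m') (g : n → n')
    (r : ℕ) :
    determinantalIdeal m n R r ≤
      (determinantalIdeal m' n' R r).comap (MvPolynomial.rename (Prod.map f g)) :=
  (determinantalIdeal_le_iff R).mpr fun ρ γ => by
    rw [Ideal.mem_comap]
    change MvPolynomial.rename (Prod.map f g) (genericMinor R ρ γ) ∈ _
    rw [rename_genericMinor]
    exact genericMinor_mem R _ _

/-- Re-indexing rows and columns along bijections preserves membership in `I_r(X)`. [folklore] -/
theorem rename_mem_determinantalIdeal_iff {m' : Type*} {n' : Type*} (em : m ≃ m') (en : n ≃ n')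
    {r : ℕ} (P : MvPolynomial (m × n) R) :
    MvPolynomial.rename (Prod.map em en) P ∈ determinantalIdeal m' n' R r ↔
      P ∈ determinantalIdeal m n R r := by
  refine ⟨fun h => ?_, fun h => determinantalIdeal_le_comap_rename R em en r h⟩
  have h' := determinantalIdeal_le_comap_rename R em.symm en.symm r h
  rw [Ideal.mem_comap, MvPolynomial.rename_rename] at h'
  have hid : (Prod.map em.symm en.symm ∘ Prod.map em en : m × n → m × n) = id := by
    funext ⟨i, j⟩
    simp
  rwa [hid, MvPolynomial.rename_id] at h'

end Bridge

section Comorphism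

variable (m n)

/-- The comorphism `μ^*` of matrix multiplication `M_{m,t} × M_{t,n} → M_{m,n}`: the
`R`-algebra map `R[X] → R[Y, Z]` sending the variable `X (i, j)` to the `(i, j)` entry
`∑ k, Y (i, k) * Z (k, j)` of the product of the generic `m × t` and `t × n` matrices
(Goodman–Wallach 2009, §5.2.1 and §12.2.4). [cite: GoodmanWallachGTM255, §12.2.4] -/
def genericProductHom (t : ℕ) :
    MvPolynomial (m × n) R →ₐ[R] MvPolynomial ((m × Fin t) ⊕ (Fin t × n)) R :=
  MvPolynomial.aeval fun ij : m × n =>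
    ∑ k : Fin t, X (Sum.inl (ij.1, k)) * X (Sum.inr (k, ij.2))

variable {m n}

/-- `μ^*` on a variable. [folklore] -/
@[simp] theorem genericProductHom_X (t : ℕ) (ij : m × n) :
    genericProductHom m n R t (X ij) =
      ∑ k : Fin t, X (Sum.inl (ij.1, k)) * X (Sum.inr (k, ij.2)) :=
  MvPolynomial.aeval_X _ _

/-- Evaluating `μ^* P` at a point `w = (x, y)` is evaluating `P` at the product matrix `x * y`.
[folklore] -/
theorem eval_genericProductHom {t : ℕ} (w : (m × Fin t) ⊕ (Fin t × n) → R)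
    (P : MvPolynomial (m × n) R) :
    MvPolynomial.eval w (genericProductHom m n R t P) =
      MvPolynomial.eval (fun ij : m × n =>
        ((Matrix.of fun i k => w (Sum.inl (i, k))) * (Matrix.of fun k j => w (Sum.inr (k, j))))
          ij.1 ij.2) P := by
  have hcomp : (MvPolynomial.eval w).comp
      (genericProductHom m n R t : MvPolynomial (m × n) R →+* _) =
      MvPolynomial.eval (fun ij : m × n =>
        ((Matrix.of fun i k => w (Sum.inl (i, k))) * (Matrix.of fun k j => w (Sum.inr (k, j))))
          ij.1 ij.2) := by
    refine MvPolynomial.ringHom_ext (fun r => ?_) (fun ij => ?_)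
    · simp [genericProductHom]
    · simp [Matrix.mul_apply]
  exact RingHom.congr_fun hcomp P

/-- The easy inclusion of the Second Fundamental Theorem, over any commutative ring:
`I_{t+1}(X) ≤ ker μ^*`, because the `(t+1) × (t+1)` minors of a product `Y Z` through inner
dimension `t` vanish identically (Goodman–Wallach 2009, §12.2.4).
[cite: GoodmanWallachGTM255, §12.2.4] -/
theorem determinantalIdeal_le_ker_genericProductHom (t : ℕ) :
    determinantalIdeal m n R (t + 1) ≤ RingHom.ker (genericProductHom m n R t) := by
  refine (determinantalIdeal_le_iff R).mpr fun ρ γ => ?_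
  rw [RingHom.mem_ker]
  change MvPolynomial.aeval _ (genericMinor R ρ γ) = 0
  rw [aeval_genericMinor]
  have hmul : (Matrix.of fun (i : m) (j : n) =>
      ∑ k : Fin t, (X (Sum.inl (i, k)) * X (Sum.inr (k, j)) :
        MvPolynomial ((m × Fin t) ⊕ (Fin t × n)) R)) =
      (Matrix.of fun (i : m) (k : Fin t) =>
          (X (Sum.inl (i, k)) : MvPolynomial ((m × Fin t) ⊕ (Fin t × n)) R)) *
        (Matrix.of fun (k : Fin t) (j : n) =>
          (X (Sum.inr (k, j)) : MvPolynomial ((m × Fin t) ⊕ (Fin t × n)) R)) :=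
    Matrix.ext fun i j => by simp [Matrix.mul_apply]
  rw [hmul]
  exact det_submatrix_mul_eq_zero (by simp) _ _ ρ γ

end Comorphism

section SFT

/-- Degenerate range `t ≥ min (#m, #n)` of the Second Fundamental Theorem (rank form): every
matrix has rank `≤ t`, so a polynomial vanishing on rank `≤ t` is zero (Goodman–Wallach 2009,
Cor. 5.2.5 (1)), and `I_{t+1}(X) = 0` because every `(t+1) × (t+1)` minor repeats a row or a
column. [cite: GoodmanWallachGTM255, Cor 5.2.5] -/
theorem forall_rank_le_eval_eq_zero_iff_of_card_le [Fintype m] [Fintype n] {t : ℕ}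
    (ht : Fintype.card m ≤ t ∨ Fintype.card n ≤ t) (P : MvPolynomial (m × n) ℂ) :
    (∀ A : Matrix m n ℂ, A.rank ≤ t →
        MvPolynomial.eval (fun ij : m × n => A ij.1 ij.2) P = 0) ↔
      P ∈ determinantalIdeal m n ℂ (t + 1) := by
  have hbot : determinantalIdeal m n ℂ (t + 1) = ⊥ := by
    rcases ht with h | h
    · exact determinantalIdeal_eq_bot_of_card_lt_left ℂ (by omega)
    · exact determinantalIdeal_eq_bot_of_card_lt_right ℂ (by omega)
  have hrank : ∀ A : Matrix m n ℂ, A.rank ≤ t := fun A => by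
    rcases ht with h | h
    · exact (Matrix.rank_le_card_height A).trans h
    · exact (Matrix.rank_le_card_width A).trans h
  rw [hbot, Ideal.mem_bot]
  refine ⟨fun H => MvPolynomial.funext fun a => ?_, ?_⟩
  · rw [map_zero]
    exact H (Matrix.of fun i j => a (i, j)) (hrank _)
  · rintro rfl A -
    simp

/-- The Second Fundamental Theorem in rank form for `Fin`-indexed matrices and every `t`:
`(∀ A, rank A ≤ t → P(A) = 0) ↔ P ∈ I_{t+1}(X)`. For `t ≤ min m n` this is the tree's
PROVED `ArbarelloEtAl1985_secondFundamentalTheorem_holds` transported along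
`determinantalIdeal_eq_detIdeal`; beyond, the degenerate case.
[cite: ArbarelloEtAl1985, Ch. II §3 (Second Fundamental Theorem of Invariant Theory)] -/
theorem forall_rank_le_eval_eq_zero_iff_fin {M N t : ℕ} (P : MvPolynomial (Fin M × Fin N) ℂ) :
    (∀ A : Matrix (Fin M) (Fin N) ℂ, A.rank ≤ t →
        MvPolynomial.eval (fun ij : Fin M × Fin N => A ij.1 ij.2) P = 0) ↔
      P ∈ determinantalIdeal (Fin M) (Fin N) ℂ (t + 1) := by
  by_cases ht : t ≤ min M N
  · rw [determinantalIdeal_eq_detIdeal]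
    exact ArbarelloEtAl1985_secondFundamentalTheorem_holds M N t ht P
  · exact forall_rank_le_eval_eq_zero_iff_of_card_le
      (by simp only [Fintype.card_fin]; omega) P

/-- **Second Fundamental Theorem for `GL_t`, rank form** (Arbarello–Cornalba–Griffiths–Harris
1985, Ch. II §3; Goodman–Wallach 2009, Thm. 12.2.12 (1)), for arbitrary finite index types and
every `t`: a polynomial `P ∈ ℂ[X]` vanishes at every complex `m × n` matrix of rank `≤ t` iff
`P ∈ I_{t+1}(X)`. Transported from the `Fin` case by re-indexing
(`rename_mem_determinantalIdeal_iff`, `Matrix.rank_submatrix`).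
[cite: ArbarelloEtAl1985, Ch. II §3 (Second Fundamental Theorem of Invariant Theory)] -/
theorem forall_rank_le_eval_eq_zero_iff [Fintype m] [Fintype n] {t : ℕ}
    (P : MvPolynomial (m × n) ℂ) :
    (∀ A : Matrix m n ℂ, A.rank ≤ t →
        MvPolynomial.eval (fun ij : m × n => A ij.1 ij.2) P = 0) ↔
      P ∈ determinantalIdeal m n ℂ (t + 1) := by
  set em := Fintype.equivFin m
  set en := Fintype.equivFin n
  rw [← rename_mem_determinantalIdeal_iff ℂ em en P, ← forall_rank_le_eval_eq_zero_iff_fin]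
  refine ⟨fun H A' hA' => ?_, fun H A hA => ?_⟩
  · rw [MvPolynomial.eval_rename]
    have hfun : ((fun ij : Fin (Fintype.card m) × Fin (Fintype.card n) => A' ij.1 ij.2) ∘
        Prod.map em en) = fun ij : m × n => (A'.submatrix em en) ij.1 ij.2 := by
      funext ij
      simp
    rw [hfun]
    exact H (A'.submatrix em en) (by simpa using hA')
  · have h' := H (A.submatrix em.symm en.symm) (by simpa using hA)
    rw [MvPolynomial.eval_rename] at h'
    have hfun : ((fun ij : Fin (Fintype.card m) × Fin (Fintype.card n) =>
        (A.submatrix em.symm en.symm) ij.1 ij.2) ∘ Prod.map em en) =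
        fun ij : m × n => A ij.1 ij.2 := by
      funext ij
      simp
    rwa [hfun] at h'

/-- Rank factorisation for arbitrary finite index types: a matrix of rank `≤ t` over a field is a
product through `F^t` (transport of the tree's `exists_eq_mul_of_rank_le`). [folklore] -/
theorem exists_eq_mul_of_rank_le_fintype {F : Type*} [Field F] [Fintype m] [Fintype n]
    {t : ℕ} (A : Matrix m n F) (hA : A.rank ≤ t) :
    ∃ (x : Matrix m (Fin t) F) (y : Matrix (Fin t) n F), A = x * y := by
  set em := Fintype.equivFin m
  set en := Fintype.equivFin n
  obtain ⟨U, W, hUW⟩ :=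
    exists_eq_mul_of_rank_le (A.submatrix em.symm en.symm) (by simpa using hA)
  refine ⟨U.submatrix em id, W.submatrix id en, ?_⟩
  rw [← Matrix.submatrix_mul _ _ _ _ _ Function.bijective_id, ← hUW]
  ext i j
  simp

/-- **Second Fundamental Theorem for `GL_t`, product form** (Goodman–Wallach 2009,
Thm. 12.2.12 (1): the `(t+1) × (t+1)` minors generate the ideal of the determinantal variety
`DV_{m,n,t} = μ(M_{m,t} × M_{t,n})`; Lemma 5.2.4 (1): `DV` = rank `≤ t`): a polynomial vanishes
at every product `x * y`, `x ∈ M_{m,t}(ℂ)`, `y ∈ M_{t,n}(ℂ)`, iff it lies in `I_{t+1}(X)`.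
All `t`, arbitrary finite index types; PROVED from the rank form.
[cite: GoodmanWallachGTM255, Thm 12.2.12] -/
theorem eval_mul_eq_zero_iff_mem_determinantalIdeal [Fintype m] [Fintype n] {t : ℕ}
    (P : MvPolynomial (m × n) ℂ) :
    (∀ (x : Matrix m (Fin t) ℂ) (y : Matrix (Fin t) n ℂ),
        MvPolynomial.eval (fun ij : m × n => (x * y) ij.1 ij.2) P = 0) ↔
      P ∈ determinantalIdeal m n ℂ (t + 1) := by
  rw [← forall_rank_le_eval_eq_zero_iff P]
  refine ⟨fun H A hA => ?_, fun H x y => H (x * y) ?_⟩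
  · obtain ⟨x, y, rfl⟩ := exists_eq_mul_of_rank_le_fintype A hA
    exact H x y
  · exact (Matrix.rank_mul_le_left x y).trans (by simpa using Matrix.rank_le_card_width x)

/-- `U Vᵀ`-parametrised form of the Second Fundamental Theorem: a polynomial vanishes at every
matrix `(∑ k, U i k * V j k)_{i,j}` with `U : m × t`, `V : n × t` iff it lies in `I_{t+1}(X)`
(the parametrisation `D_t = {U Vᵀ}` of route HartogsRankTwo; its item `KernelIsMinors` itself
is `ArbarelloEtAl1985_secondFundamentalTheorem.kernelIsMinors`).
[cite: GoodmanWallachGTM255, Thm 12.2.12] -/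
theorem forall_eval_sum_mul_eq_zero_iff [Fintype m] [Fintype n] {t : ℕ}
    (P : MvPolynomial (m × n) ℂ) :
    (∀ (U : m → Fin t → ℂ) (V : n → Fin t → ℂ),
        MvPolynomial.eval (fun ij : m × n => ∑ k : Fin t, U ij.1 k * V ij.2 k) P = 0) ↔
      P ∈ determinantalIdeal m n ℂ (t + 1) := by
  rw [← eval_mul_eq_zero_iff_mem_determinantalIdeal P]
  refine ⟨fun H x y => ?_, fun H U V => ?_⟩
  · simpa [Matrix.mul_apply] using H (fun i k => x i k) (fun j k => y k j)
  · simpa [Matrix.mul_apply] using H (Matrix.of U) (Matrix.of fun k j => V j k)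

/-- Over `ℂ`, the kernel of the comorphism `μ^* : ℂ[X] → ℂ[Y, Z]`, `X ↦ Y Z`
(`Y : m × t`, `Z : t × n`), is the determinantal ideal `I_{t+1}(X)` (Goodman–Wallach 2009,
§12.2.4: `ker μ^* = 𝔍_{m,n,t}`, with Thm. 12.2.12 (1)). PROVED.
[cite: GoodmanWallachGTM255, Thm 12.2.12] -/
theorem ker_genericProductHom_eq_determinantalIdeal [Fintype m] [Fintype n] {t : ℕ} :
    RingHom.ker (genericProductHom m n ℂ t) = determinantalIdeal m n ℂ (t + 1) := by
  ext P
  rw [RingHom.mem_ker, ← eval_mul_eq_zero_iff_mem_determinantalIdeal P, MvPolynomial.funext_iff]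
  simp only [map_zero, eval_genericProductHom]
  refine ⟨fun H x y => ?_, fun H w => H _ _⟩
  have key := H (Sum.elim (fun ik : m × Fin t => x ik.1 ik.2) (fun kj : Fin t × n => y kj.1 kj.2))
  have hx : (Matrix.of fun i k => Sum.elim (fun ik : m × Fin t => x ik.1 ik.2)
      (fun kj : Fin t × n => y kj.1 kj.2) (Sum.inl (i, k))) = x := rfl
  have hy : (Matrix.of fun k j => Sum.elim (fun ik : m × Fin t => x ik.1 ik.2)
      (fun kj : Fin t × n => y kj.1 kj.2) (Sum.inr (k, j))) = y := rfl
  rwa [hx, hy] at key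

/-- Over `ℂ`, the determinantal ideal `I_{t+1}(X)` is prime: it is the kernel of a ring map into
the domain `ℂ[Y, Z]` (Goodman–Wallach 2009, §12.2.4; Hochster–Eagon 1971 in general). PROVED.
[cite: GoodmanWallachGTM255, Thm 12.2.12] -/
theorem determinantalIdeal_isPrime [Fintype m] [Fintype n] (t : ℕ) :
    (determinantalIdeal m n ℂ (t + 1)).IsPrime := by
  rw [← ker_genericProductHom_eq_determinantalIdeal]
  exact RingHom.ker_isPrime _

/-- Over `ℂ`, the determinantal ideal `I_{t+1}(X)` is radical (Arbarello et al. 1985, Ch. II §3,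
Proposition: "`I_k` is equal to its radical"). PROVED. [cite: ArbarelloEtAl1985, Ch. II §3] -/
theorem determinantalIdeal_isRadical [Fintype m] [Fintype n] (t : ℕ) :
    (determinantalIdeal m n ℂ (t + 1)).IsRadical :=
  (determinantalIdeal_isPrime t).isRadical

end SFT

end Literature.Computability.AlgebraicComplexity
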